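import Summits.QuantumFields.BalabanUV.Beta.SymmetrisedDressingKernel
import Summits.QuantumFields.BalabanUV.Beta.HessKerDressedUnits

/-!
# `BalabanUV.Beta.FP.SymDressingUnits` — road «FP» for binder row D1, ruling R-FP-40 row #16 «KPERF-SYM» (`RESIDUAL-FP.md` §10, `AXIAL-VS-SYM.md`):
# THE SYMMETRISED CO-DRESSING `coDressKSymAt ρ N` COMMUTES WITH THE LEG UNITS `unitK` (the sym twin of asym1's `HessKerDressedUnits.axDressK_unitK`),
# IS LINEAR, AND CARRIES `Decays`-RATE DATA WITH AN EXPLICIT CONSTANT — so the co-dressed perfect resolvent `coDressKSymAt ρ N K∞` IS the constructed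
# limit of the co-dressed unit-rescaled family whenever `K∞` is the limit of the unit-rescaled family with `Decays`-rate data (m = 1 of KPERF-SYM BY TYPE,
# modulo the (CONV-C) rate data of binder row G-an2-4 — an HYPOTHESIS here, as everywhere in road FP)

HONEST DEPENDENCY (page 1, mandatory): continuum YM on T⁴ ⇐ BetaPertH ∧ nine spine estimates (0/9 proved); BetaPertH ⇐ (D1) ∧ (D4) ∧ CAP+tail;
G-an2-4 gates asym, D1 and NE2/3/4.  HONEST FRAMING (cell contract, verbatim): «discharging `BetaPertH` makes Bałaban's UV stability UNCONDITIONAL —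
a real constructive-QFT result; it is NOT the continuum limit and NOT the Clay problem.»  THIS MODULE DISCHARGES NOTHING of the wall: [folklore] kernel
algebra (a block-diagonal kernel commutes with leg-type-constant units; tame bilinearity of `comp`; `BalabanStepJetsSucc.decays_comp` twice with the
constants kept) + asym1's `HessKerDressedLimit.limMKerOf_eq_of_decays_rate` BY NAME.  No `def`, no `def … : Prop`, nothing cited, 0 sorry; 0∕4 row-D1
binders; NOT (CONV-C), NOT (ASYMP), NOT D1, NOT BetaPertH, NOT continuum, NOT Clay.  «not in print; our bookkeeping».
ABSOLUTE RULE (cell charter, verbatim): «No internally-minted statement may enter as a cited fact. Every hypothesis is either kernel-proved in this package or a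
verbatim quotation of a PUBLISHED theorem with page reference. The manuscript(s) under audit are NOT citable for their own disputed steps — they are the thing
under adjudication; programme-internal (2001/route/tribunal) claims are never citable.»

WHAT.
* §1 [folklore] `comp_trK_scaleK_comp_of_comm` — for ANY kernel `P` commuting entrywise with a fibre weight `u` (`u a · P x y a b = P x y a b · u b`) and any `K`:
  `Pᵀ∘(D K D)∘P = D (Pᵀ∘K∘P) D`, `D = scaleK u u` (unconditional: constants move through `∑'` and `Σ`); `legScale_comm_piKSymBm` — the block-mean projector
  kernel `piKSymBm ρ N` (field–field and multiplier–multiplier blocks only) commutes with `legScale sf sm`; hence **`coDressKSymAt_unitK`**: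
  `coDressKSymAt ρ N (unitK sf sm K) = unitK sf sm (coDressKSymAt ρ N K)`.
* §2 [folklore] `coDressKSymAt_sub` (spread `K`, `K′`; in-block root): `coDressKSymAt ρ N (K − K′) = coDressKSymAt ρ N K − coDressKSymAt ρ N K′`;
  **`decays_coDressKSymAt_explicit`**: `Decays K C δ ⟹ Decays (coDressKSymAt ρ N K) (cCo d N δ′… · C) (δ∕4)` with the constant DISPLAYED and LINEAR in `C`
  (`SymmetrisedDressingKernel.decays_coDressKSymAt` hides it behind `∃`).
* §3 [folklore] **`decays_rate_coDressKSymAt`**: rate data `Decays (K j − K∞) (c·θ^j) δ` ⟹ rate data `Decays (coDressKSymAt (K j) − coDressKSymAt K∞) (κ·c·θ^j) (δ∕4)`;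
  **`limMKerOf_coDressKSymAt_eq`**: hence `limMKerOf (j ↦ coDressKSymAt ρ N (K j)) = coDressKSymAt ρ N K∞` (`0 ≤ θ < 1`); **`limMKerOf_coDressKSymAt_unitK_eq`**:
  the same for the unit-rescaled family `j ↦ coDressKSymAt ρ N (unitK (sf j) (sm j) (K j))` against `unitK`-rate data — the shape road FP's `KPerf … 1`
  (`= limMKerOf (j ↦ unitK (sf j) (sm j) (KInvStep Lc j))`, `PerfectObjectsT.KPerf_one`) supplies once (CONV-C) gives the rate.
Provenance: road FP OWNER b2b-balaban-beta-d1-p3 gen 10 (prover-b2b-balaban-beta-d1-p3-g10-0), 2026-08-21, R-FP-40 row #16.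
-/

noncomputable section

namespace Summit.QuantumFields.BalabanUV.Beta.FP.SymDressingUnits

open Finset Filter
open scoped BigOperators
open Literature.MathematicalPhysics.QuantumFieldTheory.Balaban1983to89
open Literature.MathematicalPhysics.QuantumFieldTheory.Balaban1983to89.Beta
open ExpKernelCalculus (MKer Decays comp Zl)
open HessKerRate (scaleK scaleK_apply)
open OneStepResolventKernel (Fib)
open AffineAveraging (box toSite)
open HessKerDressedLimit (limMKerOf limMKerOf_eq_of_decays_rate)
open Summit.QuantumFields.BalabanUV.Beta.TameKernelCalculus
open Summit.QuantumFields.BalabanUV.Beta.HessKerDressedUnits (legScale legScale_inl legScale_inr unitK unitK_sub)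
open Summit.QuantumFields.BalabanUV.Beta.AxialDressingRooted (cPb spr_comp)
open Summit.QuantumFields.BalabanUV.Beta.SymmetrisedDressingKernel (piKSymBm piKSymBm_inl_inr piKSymBm_inr_inl coDressKSymAt coDressKSymAt_eq
  decays_piKSymBm)

variable {d : ℕ}

/-! ## §1 A kernel commuting with the leg units passes them through the co-dressing -/

section Units

/-- [folklore] **`Pᵀ∘(D K D)∘P = D (Pᵀ∘K∘P) D`** for a kernel `P` commuting entrywise with the fibre weight `u` (`D = scaleK u u`; no summability needed —
constants move through `∑'`). -/
theorem comp_trK_scaleK_comp_of_comm {D : ℕ} {F : Type*} [Fintype F] {u : F → ℝ} {P : MKer D F}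
    (hP : ∀ x y a b, u a * P x y a b = P x y a b * u b) (K : MKer D F) :
    comp (comp (trK P) (scaleK u u K)) P = scaleK u u (comp (comp (trK P) K) P) := by
  funext x y a b
  simp only [ExpKernelCalculus.comp, trK, scaleK_apply]
  have inner : ∀ (z : Fin D → ℤ) (g : F),
      (∑' w, ∑ f, P w x f a * (u f * K w z f g * u g)) = u a * (∑' w, ∑ f, P w x f a * K w z f g) * u g := by
    intro z g
    rw [← tsum_mul_left, ← tsum_mul_right]
    refine tsum_congr fun w => ?_
    rw [Finset.mul_sum, Finset.sum_mul]
    refine Finset.sum_congr rfl fun f _ => ?_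
    have h1 := hP w x f a
    calc P w x f a * (u f * K w z f g * u g) = (u f * P w x f a) * K w z f g * u g := by ring
      _ = (P w x f a * u a) * K w z f g * u g := by rw [h1]
      _ = u a * (P w x f a * K w z f g) * u g := by ring
  calc (∑' z, ∑ g, (∑' w, ∑ f, P w x f a * (u f * K w z f g * u g)) * P z y g b)
      = ∑' z, ∑ g, u a * ((∑' w, ∑ f, P w x f a * K w z f g) * P z y g b) * u b := by
        refine tsum_congr fun z => Finset.sum_congr rfl fun g _ => ?_
        rw [inner z g]
        have h2 := hP z y g b
        calc u a * (∑' w, ∑ f, P w x f a * K w z f g) * u g * P z y g b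
            = u a * (∑' w, ∑ f, P w x f a * K w z f g) * (u g * P z y g b) := by ring
          _ = u a * (∑' w, ∑ f, P w x f a * K w z f g) * (P z y g b * u b) := by rw [h2]
          _ = u a * ((∑' w, ∑ f, P w x f a * K w z f g) * P z y g b) * u b := by ring
    _ = u a * (∑' z, ∑ g, (∑' w, ∑ f, P w x f a * K w z f g) * P z y g b) * u b := by
        rw [← tsum_mul_left, ← tsum_mul_right]
        refine tsum_congr fun z => ?_
        rw [Finset.mul_sum, Finset.sum_mul]

/-- [folklore] **THE BLOCK-MEAN PROJECTOR KERNEL COMMUTES WITH THE LEG UNITS**: `piKSymBm ρ N` has only field–field and multiplier–multiplier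
blocks, and `legScale sf sm` is constant on each leg type. -/
theorem legScale_comm_piKSymBm (ρ : Fin (d + 1) → ℤ) (N : ℕ) (sf sm : ℝ) (x y : Fin (d + 1) → ℤ) (a b : Fib d) :
    legScale sf sm a * piKSymBm ρ N x y a b = piKSymBm ρ N x y a b * legScale sf sm b := by
  rcases a with α | m <;> rcases b with β | m'
  · rw [legScale_inl, legScale_inl, mul_comm]
  · rw [piKSymBm_inl_inr, mul_zero, zero_mul]
  · rw [piKSymBm_inr_inl, mul_zero, zero_mul]
  · rw [legScale_inr, legScale_inr, mul_comm]

/-- [folklore] **THE SYMMETRISED CO-DRESSING COMMUTES WITH THE LEG UNITS** (sym twin of `HessKerDressedUnits.axDressK_unitK`):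
`coDressKSymAt ρ N (D K D) = D (coDressKSymAt ρ N K) D`. -/
theorem coDressKSymAt_unitK (ρ : Fin (d + 1) → ℤ) (N : ℕ) (sf sm : ℝ) (K : MKer (d + 1) (Fib d)) :
    coDressKSymAt ρ N (unitK sf sm K) = unitK sf sm (coDressKSymAt ρ N K) := by
  rw [coDressKSymAt_eq, coDressKSymAt_eq]
  exact comp_trK_scaleK_comp_of_comm (fun x y a b => legScale_comm_piKSymBm ρ N sf sm x y a b) K

end Units

/-! ## §2 Linearity and `Decays` with the constant displayed -/

section Linear

variable {N : ℕ} {r : Fin (d + 1) → ℕ}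

/-- [folklore] **THE CO-DRESSING IS ADDITIVE** on spread kernels (in-block root): `coDressKSymAt (K − K′) = coDressKSymAt K − coDressKSymAt K′`. -/
theorem coDressKSymAt_sub (hN : 1 ≤ N) (hr : r ∈ box (d + 1) N) {K K' : MKer (d + 1) (Fib d)} (hK : Spr K) (hK' : Spr K') :
    coDressKSymAt (toSite r) N (K - K') = coDressKSymAt (toSite r) N K - coDressKSymAt (toSite r) N K' := by
  have sP : Spr (piKSymBm (toSite r) N) := ⟨_, 1, one_pos, decays_piKSymBm hN hr zero_le_one⟩
  have sPt : Spr (trK (piKSymBm (toSite r) N)) := sP.trK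
  rw [coDressKSymAt_eq, coDressKSymAt_eq, coDressKSymAt_eq, comp_sub_right_tame sPt.tame hK.tame hK'.tame,
    comp_sub_left_tame (spr_comp sPt hK).tame (spr_comp sPt hK').tame sP.tame]

/-- [folklore] **`Decays` OF THE CO-DRESSED KERNEL WITH THE CONSTANT DISPLAYED AND LINEAR IN `C`** (`decays_comp` twice, rates `δ ↦ δ∕2 ↦ δ∕4`;
`SymmetrisedDressingKernel.decays_coDressKSymAt` is the `∃`-form). -/
theorem decays_coDressKSymAt_explicit (hN : 1 ≤ N) (hr : r ∈ box (d + 1) N) {K : MKer (d + 1) (Fib d)} {C δ : ℝ} (hδ : 0 < δ)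
    (hK : Decays K C δ) :
    Decays (coDressKSymAt (toSite r) N K)
      ((Fintype.card (Fib d) : ℝ) * ((Fintype.card (Fib d) : ℝ) * (cPb d N δ * C) * Zl (d + 1) (δ - δ / 2) * cPb d N (δ / 2))
        * Zl (d + 1) (δ / 2 - δ / 4)) (δ / 4) := by
  have hPt : Decays (trK (piKSymBm (toSite r) N)) (cPb d N δ) δ := decays_trK (decays_piKSymBm hN hr hδ.le)
  have h1 := BalabanStepJetsSucc.decays_comp hPt hK (show 0 ≤ δ / 2 by linarith) (show δ / 2 < δ by linarith)
  have hP : Decays (piKSymBm (toSite r) N) (cPb d N (δ / 2)) (δ / 2) := decays_piKSymBm hN hr (by linarith)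
  have h2 := BalabanStepJetsSucc.decays_comp h1 hP (show 0 ≤ δ / 4 by linarith) (show δ / 4 < δ / 2 by linarith)
  rw [coDressKSymAt_eq]
  exact h2

end Linear

/-! ## §3 Rate data passes through the co-dressing; the co-dressed limit IS the limit of the co-dressed family -/

section Limit

variable {N : ℕ} {r : Fin (d + 1) → ℕ}

/-- [folklore] **RATE DATA PASSES THROUGH THE CO-DRESSING**: `Decays (K j − K∞) (c·θ^j) δ` for every `j` (all kernels decaying at rate `δ`) ⟹
`Decays (coDressKSymAt (K j) − coDressKSymAt K∞) (κ·(c·θ^j)) (δ∕4)` with `κ` the displayed constant of §2 at `C := 1`-slot. -/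
theorem decays_rate_coDressKSymAt (hN : 1 ≤ N) (hr : r ∈ box (d + 1) N) {K : ℕ → MKer (d + 1) (Fib d)} {Kinf : MKer (d + 1) (Fib d)}
    {C c δ θ : ℝ} (hδ : 0 < δ) (hKj : ∀ j, Decays (K j) C δ) (hKinf : Decays Kinf C δ) (h : ∀ j, Decays (K j - Kinf) (c * θ ^ j) δ) (j : ℕ) :
    Decays (coDressKSymAt (toSite r) N (K j) - coDressKSymAt (toSite r) N Kinf)
      (((Fintype.card (Fib d) : ℝ) * ((Fintype.card (Fib d) : ℝ) * (cPb d N δ) * Zl (d + 1) (δ - δ / 2) * cPb d N (δ / 2))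
        * Zl (d + 1) (δ / 2 - δ / 4)) * (c * θ ^ j)) (δ / 4) := by
  rw [← coDressKSymAt_sub hN hr ⟨C, δ, hδ, hKj j⟩ ⟨C, δ, hδ, hKinf⟩]
  have hmain := decays_coDressKSymAt_explicit hN hr hδ (h j)
  refine fun x y a b => (hmain x y a b).trans (le_of_eq ?_)
  ring

/-- [folklore] **THE CO-DRESSED LIMIT IS THE LIMIT OF THE CO-DRESSED FAMILY** (`0 ≤ θ < 1`): under `Decays`-rate data of `K j` to `K∞`,
`limMKerOf (j ↦ coDressKSymAt ρ N (K j)) = coDressKSymAt ρ N K∞` (asym1's uniqueness `limMKerOf_eq_of_decays_rate` at the transferred rate). -/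
theorem limMKerOf_coDressKSymAt_eq (hN : 1 ≤ N) (hr : r ∈ box (d + 1) N) {K : ℕ → MKer (d + 1) (Fib d)} {Kinf : MKer (d + 1) (Fib d)}
    {C c δ θ : ℝ} (hδ : 0 < δ) (hKj : ∀ j, Decays (K j) C δ) (hKinf : Decays Kinf C δ) (h : ∀ j, Decays (K j - Kinf) (c * θ ^ j) δ)
    (hθ0 : 0 ≤ θ) (hθ1 : θ < 1) :
    limMKerOf (fun j => coDressKSymAt (toSite r) N (K j)) = coDressKSymAt (toSite r) N Kinf := by
  refine limMKerOf_eq_of_decays_rate (c := ((Fintype.card (Fib d) : ℝ) * ((Fintype.card (Fib d) : ℝ) * (cPb d N δ) * Zl (d + 1) (δ - δ / 2)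
    * cPb d N (δ / 2)) * Zl (d + 1) (δ / 2 - δ / 4)) * c) (δ := δ / 4) (fun k => ?_) hθ0 hθ1
  have := decays_rate_coDressKSymAt hN hr hδ hKj hKinf h k
  refine fun x y a b => (this x y a b).trans (le_of_eq ?_)
  ring

/-- [folklore] **THE SAME FOR THE UNIT-RESCALED FAMILY** (the shape of road FP's `KPerf … 1 = limMKerOf (j ↦ unitK (sf j) (sm j) (KInvStep Lc j))`,
`PerfectObjectsT.KPerf_one`): if the unit-rescaled resolvents `unitK (sf j) (sm j) (K j)` decay uniformly and converge to `K∞` with `Decays`-rate data, then the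
co-dressed unit-rescaled family — which IS the unit-rescaled co-dressed family (`coDressKSymAt_unitK`) — converges to `coDressKSymAt ρ N K∞`, and that kernel is
its constructed limit. -/
theorem limMKerOf_coDressKSymAt_unitK_eq (hN : 1 ≤ N) (hr : r ∈ box (d + 1) N) {K : ℕ → MKer (d + 1) (Fib d)} {Kinf : MKer (d + 1) (Fib d)}
    (sf sm : ℕ → ℝ) {C c δ θ : ℝ} (hδ : 0 < δ) (hKj : ∀ j, Decays (unitK (sf j) (sm j) (K j)) C δ) (hKinf : Decays Kinf C δ)
    (h : ∀ j, Decays (unitK (sf j) (sm j) (K j) - Kinf) (c * θ ^ j) δ) (hθ0 : 0 ≤ θ) (hθ1 : θ < 1) :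
    limMKerOf (fun j => unitK (sf j) (sm j) (coDressKSymAt (toSite r) N (K j))) = coDressKSymAt (toSite r) N Kinf := by
  have hfam : (fun j => unitK (sf j) (sm j) (coDressKSymAt (toSite r) N (K j))) = fun j => coDressKSymAt (toSite r) N (unitK (sf j) (sm j) (K j)) :=
    funext fun j => (coDressKSymAt_unitK (toSite r) N (sf j) (sm j) (K j)).symm
  rw [hfam]
  exact limMKerOf_coDressKSymAt_eq hN hr hδ hKj hKinf h hθ0 hθ1

end Limit

end Summit.QuantumFields.BalabanUV.Beta.FP.SymDressingUnits

end
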